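import Summits.Ventures.LatticeQCDFlow.Scoring.TorusAreaLaw2DBound
import Literature.MathematicalPhysics.QuantumFieldTheory.LatticeGaugeStringTensionProofs
import Literature.RepresentationTheory.CompactGroups.UnitaryTrick
import Literature.MathematicalPhysics.QuantumLattice.TwistedBoundaryConditions
import HarnessLib

/-!
# The exact non-abelian area law in two dimensions, V-d: `HasAreaLaw 2 ρ β` — TWO-DIMENSIONAL `U(N)` AND `SU(N)` LATTICE YANG–MILLS SATISFY THE VOLUME-UNIFORM AREA LAW AT EVERY COUPLING

HONEST FRAMING: exact (Metropolis-corrected) sampling algorithms for lattice gauge theory;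
figures of merit are autocorrelation/cost numbers at stated couplings and volumes; no
continuum-physics claim.

Venture `LatticeQCDFlow` (cell pub-lqcd), sub-topic `Scoring`; FANOUT row 5 (`s0-sun-a`), GEN-18.
NEW WORK of the cell (placement rule).  `Literature…ConstructiveQFTWave0.HasAreaLaw d ρ β` (S12: Seiler LNP 159
§2; Chatterjee; Cao–Park–Sheffield — the volume-uniform finite-torus area law) asks for constants `C`, `c > 0`
with `|⟨W_{R×T}⟩_{(ℤ/L)^d, β}| ≤ C^{2(R+T)} e^{−cRT}` for every torus size `L`, every plane and every loop with
`1 ≤ R, T ≤ L/2`.  The tree proves it in every dimension at STRONG coupling (`DurhuusFrohlichSlabCriterion`,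
`THooftRegimeThresholds`).  Here, in `d = 2`, at EVERY real `β`:

* **`hasAreaLaw_two_of_scalar`** — every compact second-countable `G` and continuous `ρ` whose Wilson-weight
  one-plaquette matrix is a scalar `c·1` with `‖c‖ < ∫ e^{−β(N−Re tr ρ)} dHaar`: `HasAreaLaw 2 ρ β`, from part
  V-c's bound `|⟨W⟩| ≤ P^{RT} + K q^{2RT}` (`θ = max(P, q², ½)`, `c = −log θ`, `C = 1 + K`); the `(1,0)`
  plane is the `(0,1)` plane with `R ↔ T` (`rectangleHolonomy_symm`, `Re tr ρ(g⁻¹) = Re tr ρ(g)`);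
* **`hasAreaLaw_two_of_trace_re_lt`** — the same when the scalar is the real number `N⁻¹ ∫ Re tr ρ · w`
  (as `OnePlaquetteMatrixSchur` provides) and SOME `ρ(g₀)` has `Re tr ρ(g₀) < N`: then
  `|∫ Re tr ρ · w| < N ∫ w` because `N ± Re tr ρ > 0` at `g = 1`, resp. `g = g₀`, and Haar charges open sets;
* **`hasAreaLaw_two_of_isIrreducibleFamily`** — EVERY CONTINUOUS REPRESENTATION WITH TRIVIAL COMMUTANT
  (`Literature…IsIrreducibleFamily ρ`: the matrices commuting with all `ρ(g)` are the scalars — every irreducible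
  representation, by Schur's lemma) some value of which has `‖tr ρ(g₀)‖ < N` (i.e. some `ρ(g₀)` is not a scalar
  multiple of a unitary scalar; automatic for irreducible `N ≥ 2`) satisfies `HasAreaLaw 2 ρ β` at every real `β`:
  the one-plaquette matrix commutes with `ρ` (`rep_mul_integralMatrix_comm`, part III), so it is a scalar `c·1` with
  `Nc = ∫ tr ρ · w`, and `‖∫ tr ρ · w‖ ≤ ∫ ‖tr ρ‖ w < N ∫ w` (`‖tr ρ(g)‖ ≤ N` by Weyl's unitarian trick);
* **`hasAreaLaw_two_unitary`** — `HasAreaLaw 2 (unitaryFundamentalRep (Fin N) ℂ) β`, every `N ≥ 1`, `β ∈ ℝ`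
  (`g₀ = −1`);
* **`hasAreaLaw_two_specialUnitary`** — `HasAreaLaw 2 (fundamentalRep (Fin N)) β`, every `N ≥ 2`, `β ∈ ℝ`
  (`g₀ = diag(−1, −1, 1, …, 1)`; `SU(1)` is trivial, `⟨W⟩ = 1`).

No `def`, nothing cited as a fact, 0 sorry.
-/

noncomputable section

open MeasureTheory Function Finset
open Literature.MathematicalPhysics.QuantumFieldTheory
open Literature.MathematicalPhysics.QuantumLattice
open Literature.RepresentationTheory.CompactGroups
open Summit.Ventures.LatticeQCDFlow.Theory2.Lattice
open Summit.Ventures.LatticeQCDFlow.Theory2.Lattice.TwoDim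

namespace Summit.Ventures.LatticeQCDFlow.Scoring

section General

variable {G : Type*} [Group G] [TopologicalSpace G] [IsTopologicalGroup G]
  [CompactSpace G] [SecondCountableTopology G] [MeasurableSpace G] [BorelSpace G] {N : ℕ}
  (ρ : G →* Matrix (Fin N) (Fin N) ℂ)

omit [SecondCountableTopology G] [MeasurableSpace G] [BorelSpace G] in
/-- In the `(1,0)` plane the Wilson loop is the `(0,1)` loop with `R` and `T` exchanged
(`Re tr ρ(g⁻¹) = Re tr ρ(g)` on a compact group). -/
theorem wilsonLoop_one_zero (hρ : Continuous ρ) {L : ℕ} (x : Site 2 L) (R T : ℕ)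
    (U : GaugeConfig 2 L G) : wilsonLoop ρ x 1 0 R T U = wilsonLoop ρ x 0 1 T R U := by
  unfold wilsonLoop
  rw [StringTension.rectangleHolonomy_symm U x 0 1 T R, CompactGroup.re_trace_map_inv ρ hρ]

/-- **`HasAreaLaw` in two dimensions from a scalar one-plaquette matrix.**  If the Wilson-weight
one-plaquette matrix of the continuous representation `ρ` is `c·1` with `‖c‖ < ∫ e^{−β(N − Re tr ρ)} dHaar`,
the two-dimensional torus theory satisfies the volume-uniform area law `HasAreaLaw 2 ρ β`. -/
theorem hasAreaLaw_two_of_scalar [NeZero N] (hρ : Continuous ρ) (β : ℝ) {c : ℂ}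
    (hM : (Matrix.of fun k l : Fin N => ∫ g, ρ g k l *
      (Real.exp (-(β * ((N : ℝ) - (ρ g).trace.re))) : ℂ) ∂(haarProbability G)) =
        c • (1 : Matrix (Fin N) (Fin N) ℂ))
    (hc : ‖c‖ < ∫ g, Real.exp (-(β * ((N : ℝ) - (ρ g).trace.re))) ∂(haarProbability G)) :
    HasAreaLaw 2 ρ β := by
  obtain ⟨B, hB0, hB⟩ := exists_bound_trace_re_nonneg ρ hρ
  have hw : Continuous fun g : G => Real.exp (-(β * ((N : ℝ) - (ρ g).trace.re))) := by
    have := Complex.continuous_re.comp hρ.matrix_trace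
    fun_prop
  have hbound : ∀ g : G, |β * ((N : ℝ) - (ρ g).trace.re)| ≤ |β| * (N + B) := fun g => by
    rw [abs_mul]
    refine mul_le_mul_of_nonneg_left ?_ (abs_nonneg β)
    have h2 : |((N : ℝ) - (ρ g).trace.re)| ≤ |(N : ℝ)| + |(ρ g).trace.re| := abs_sub _ _
    rw [Nat.abs_cast] at h2
    linarith [hB g]
  have hwlo : ∀ g : G, Real.exp (-(|β| * (N + B))) ≤ Real.exp (-(β * ((N : ℝ) - (ρ g).trace.re))) :=
    fun g => Real.exp_le_exp.mpr (by linarith [(abs_le.mp (hbound g)).2])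
  set m : ℝ := ∫ g, Real.exp (-(β * ((N : ℝ) - (ρ g).trace.re))) ∂(haarProbability G) with hm_def
  set c₀ : ℝ := Real.exp (-(|β| * (N + B))) with hc₀_def
  set s₁ : ℝ := Real.exp (|β| * (N + B)) with hs₁_def
  have hc₀ : 0 < c₀ := Real.exp_pos _
  have hm_pos : 0 < m := lt_of_le_of_lt (norm_nonneg c) hc
  have hm_lo : c₀ ≤ m := by
    have h : ∫ _g : G, c₀ ∂(haarProbability G) ≤ m :=
      integral_mono (integrable_const c₀) (integrable_haarProbability_of_continuous hw) hwlo
    simpa using h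
  -- the rate and the constants
  set P : ℝ := ‖c‖ / m with hP_def
  set q : ℝ := (1 - c₀ / m) ^ 2 with hq_def
  set K : ℝ := B / N * s₁ / c₀ with hK_def
  set θ : ℝ := max (max P q) (1 / 2) with hθ_def
  have hP0 : 0 ≤ P := div_nonneg (norm_nonneg c) hm_pos.le
  have hP1 : P < 1 := (div_lt_one hm_pos).mpr hc
  have hq0 : 0 ≤ q := sq_nonneg _
  have hq1 : q < 1 := by
    rw [hq_def, sq_lt_one_iff₀ (by rw [sub_nonneg]; exact (div_le_one hm_pos).mpr hm_lo)]
    have : 0 < c₀ / m := div_pos hc₀ hm_pos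
    linarith
  have hθpos : 0 < θ := lt_of_lt_of_le (by norm_num) (le_max_right _ _)
  have hθ1 : θ < 1 := max_lt (max_lt hP1 hq1) (by norm_num)
  have hK0 : 0 ≤ K := by positivity
  refine ⟨1 + K, -Real.log θ, neg_pos.mpr (Real.log_neg hθpos hθ1), ?_⟩
  intro L _ x i j R T hij hR1 hT1 h2R h2T
  have hL : 2 ≤ L := by omega
  -- the bound in the `(0,1)` plane, for any `R, T`
  have key : ∀ R T : ℕ, 1 ≤ R → 1 ≤ T → 2 * R ≤ L → 2 * T ≤ L →
      |wilsonExpectation ρ β (wilsonLoop ρ x 0 1 R T)| ≤ (1 + K) ^ (2 * (R + T)) *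
        Real.exp (-(-Real.log θ) * ((R : ℝ) * (T : ℝ))) := by
    intro R T hR1 hT1 h2R h2T
    have h := abs_wilsonExpectation_loop_le ρ hρ β hB0 hB hM hL x hR1 hT1 h2R h2T
    have hexp : Real.exp (-(-Real.log θ) * ((R : ℝ) * (T : ℝ))) = θ ^ (R * T) := by
      rw [neg_neg, ← Nat.cast_mul, mul_comm, Real.exp_nat_mul, Real.exp_log hθpos]
    rw [hexp]
    have hPθ : P ^ (R * T) ≤ θ ^ (R * T) :=
      pow_le_pow_left₀ hP0 ((le_max_left _ _).trans (le_max_left _ _)) _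
    have hqθ : (1 - c₀ / m) ^ (2 * (R * T)) ≤ θ ^ (R * T) := by
      rw [pow_mul]
      exact pow_le_pow_left₀ hq0 ((le_max_right _ _).trans (le_max_left _ _)) _
    have hC : (1 + K) ≤ (1 + K) ^ (2 * (R + T)) := le_self_pow₀ (by linarith) (by omega)
    calc |wilsonExpectation ρ β (wilsonLoop ρ x 0 1 R T)|
        ≤ P ^ (R * T) + K * (1 - c₀ / m) ^ (2 * (R * T)) := h
      _ ≤ θ ^ (R * T) + K * θ ^ (R * T) := add_le_add hPθ (mul_le_mul_of_nonneg_left hqθ hK0)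
      _ = (1 + K) * θ ^ (R * T) := by ring
      _ ≤ (1 + K) ^ (2 * (R + T)) * θ ^ (R * T) :=
          mul_le_mul_of_nonneg_right hC (pow_nonneg hθpos.le _)
  -- the two planes
  have h01 : ∀ k : Fin 2, k = 0 ∨ k = 1 := by decide
  rcases h01 i with rfl | rfl <;> rcases h01 j with rfl | rfl
  · exact absurd rfl hij
  · exact key R T hR1 hT1 h2R h2T
  · rw [show wilsonLoop ρ x 1 0 R T = wilsonLoop ρ x 0 1 T R from
        funext fun U => wilsonLoop_one_zero ρ hρ x R T U,
      show 2 * (R + T) = 2 * (T + R) by ring, show (R : ℝ) * T = T * R by ring]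
    exact key T R hT1 hR1 h2T h2R
  · exact absurd rfl hij

/-- **`HasAreaLaw` in two dimensions from a REAL scalar one-plaquette matrix.**  If the Wilson-weight
one-plaquette matrix of `ρ` is `(N⁻¹ ∫ Re tr ρ(g) e^{−β(N − Re tr ρ(g))} dg)·1` (as for the defining
representations of `U(N)` and `SU(N)`, `OnePlaquetteMatrixSchur`) and some `ρ(g₀)` has `Re tr ρ(g₀) < N`,
then `HasAreaLaw 2 ρ β`: the scalar is strictly shorter than `∫ e^{−β(N − Re tr ρ)}` because
`N ± Re tr ρ(g) ≥ 0` everywhere and `> 0` at `g = 1`, resp. `g = g₀`, and Haar charges open sets. -/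
theorem hasAreaLaw_two_of_trace_re_lt [NeZero N] (hρ : Continuous ρ) (β : ℝ)
    (hM : (Matrix.of fun k l : Fin N => ∫ g, ρ g k l *
      (Real.exp (-(β * ((N : ℝ) - (ρ g).trace.re))) : ℂ) ∂(haarProbability G)) =
        (((N : ℝ)⁻¹ * ∫ g, (ρ g).trace.re * Real.exp (-(β * ((N : ℝ) - (ρ g).trace.re)))
          ∂(haarProbability G) : ℝ) : ℂ) • (1 : Matrix (Fin N) (Fin N) ℂ))
    (hlt : ∃ g₀ : G, (ρ g₀).trace.re < N) : HasAreaLaw 2 ρ β := by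
  refine hasAreaLaw_two_of_scalar ρ hρ β hM ?_
  rw [Complex.norm_real, Real.norm_eq_abs]
  obtain ⟨g₀, hg₀⟩ := hlt
  have hN : (0 : ℝ) < N := Nat.cast_pos.mpr (NeZero.pos N)
  have htr : Continuous fun g : G => (ρ g).trace.re := Complex.continuous_re.comp hρ.matrix_trace
  have hw : Continuous fun g : G => Real.exp (-(β * ((N : ℝ) - (ρ g).trace.re))) := by
    have := htr
    fun_prop
  have hle : ∀ g : G, |(ρ g).trace.re| ≤ N := fun g => by
    simpa using CompactGroup.abs_re_trace_le_card ρ hρ g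
  -- the two positive integrals `∫ (N ± Re tr ρ) w > 0`
  have hplus : 0 < ∫ g, ((N : ℝ) + (ρ g).trace.re) * Real.exp (-(β * ((N : ℝ) - (ρ g).trace.re)))
      ∂(haarProbability G) := by
    refine Continuous.integral_pos_of_hasCompactSupport_nonneg_nonzero (x := 1)
      ((continuous_const.add htr).mul hw) (HasCompactSupport.of_compactSpace _)
      (fun g => mul_nonneg (by linarith [neg_abs_le ((ρ g).trace.re), hle g]) (Real.exp_pos _).le) ?_
    have h1 : (ρ 1).trace.re = N := by
      rw [map_one, Matrix.trace_one, Fintype.card_fin, Complex.natCast_re]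
    rw [h1]
    exact mul_ne_zero (by linarith) (Real.exp_pos _).ne'
  have hminus : 0 < ∫ g, ((N : ℝ) - (ρ g).trace.re) * Real.exp (-(β * ((N : ℝ) - (ρ g).trace.re)))
      ∂(haarProbability G) := by
    refine Continuous.integral_pos_of_hasCompactSupport_nonneg_nonzero (x := g₀)
      ((continuous_const.sub htr).mul hw) (HasCompactSupport.of_compactSpace _)
      (fun g => mul_nonneg (by linarith [le_abs_self ((ρ g).trace.re), hle g]) (Real.exp_pos _).le) ?_
    exact mul_ne_zero (by linarith) (Real.exp_pos _).ne'
  have hwi : Integrable (fun g : G => Real.exp (-(β * ((N : ℝ) - (ρ g).trace.re)))) (haarProbability G) :=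
    integrable_haarProbability_of_continuous hw
  have htwi : Integrable (fun g : G => (ρ g).trace.re * Real.exp (-(β * ((N : ℝ) - (ρ g).trace.re))))
      (haarProbability G) :=
    integrable_haarProbability_of_continuous (htr.mul hw)
  have h1 : ∫ g, ((N : ℝ) + (ρ g).trace.re) * Real.exp (-(β * ((N : ℝ) - (ρ g).trace.re)))
      ∂(haarProbability G) =
      N * (∫ g, Real.exp (-(β * ((N : ℝ) - (ρ g).trace.re))) ∂(haarProbability G)) +
        ∫ g, (ρ g).trace.re * Real.exp (-(β * ((N : ℝ) - (ρ g).trace.re))) ∂(haarProbability G) := by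
    simp_rw [add_mul]
    rw [integral_add (hwi.const_mul _) htwi, integral_const_mul]
  have h2 : ∫ g, ((N : ℝ) - (ρ g).trace.re) * Real.exp (-(β * ((N : ℝ) - (ρ g).trace.re)))
      ∂(haarProbability G) =
      N * (∫ g, Real.exp (-(β * ((N : ℝ) - (ρ g).trace.re))) ∂(haarProbability G)) -
        ∫ g, (ρ g).trace.re * Real.exp (-(β * ((N : ℝ) - (ρ g).trace.re))) ∂(haarProbability G) := by
    simp_rw [sub_mul]
    rw [integral_sub (hwi.const_mul _) htwi, integral_const_mul]
  rw [h1] at hplus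
  rw [h2] at hminus
  rw [abs_mul, abs_inv, Nat.abs_cast, ← div_eq_inv_mul, div_lt_iff₀ hN, abs_lt]
  constructor <;> linarith

omit [SecondCountableTopology G] [MeasurableSpace G] [BorelSpace G] in
/-- `‖tr ρ(g)‖ ≤ N` for a continuous `N`-dimensional representation of a compact group: `ρ` is conjugate to a
unitary representation (Weyl's unitarian trick, `CompactGroup.unitarize`), whose entries have norm `≤ 1`. -/
theorem norm_trace_le_card (hρ : Continuous ρ) (g : G) : ‖(ρ g).trace‖ ≤ N := by
  rw [← CompactGroup.trace_unitarize ρ hρ g]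
  calc ‖(CompactGroup.unitarize ρ hρ g).trace‖ = ‖∑ i, CompactGroup.unitarize ρ hρ g i i‖ := rfl
    _ ≤ ∑ i, ‖CompactGroup.unitarize ρ hρ g i i‖ := norm_sum_le _ _
    _ ≤ ∑ _i : Fin N, (1 : ℝ) :=
        Finset.sum_le_sum fun i _ => CompactGroup.norm_unitarize_apply_le_one ρ hρ g i i
    _ = N := by simp

/-- **EVERY IRREDUCIBLE REPRESENTATION OF EVERY COMPACT GROUP CONFINES IN TWO DIMENSIONS, AT EVERY COUPLING.**
If the continuous representation `ρ : G → M_N(ℂ)` has trivial commutant (`IsIrreducibleFamily ρ` — Schur's lemma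
for an irreducible `ρ`) and some `ρ(g₀)` has `‖tr ρ(g₀)‖ < N`, then `HasAreaLaw 2 ρ β` for every real `β`:
the Wilson-weight one-plaquette matrix commutes with `ρ` (`rep_mul_integralMatrix_comm`), hence is a scalar
`c·1` with `N c = ∫ tr ρ(g) e^{−β(N − Re tr ρ(g))} dg`, and `‖N c‖ ≤ ∫ ‖tr ρ‖ w < N ∫ w` because `‖tr ρ(g)‖ ≤ N`
everywhere (unitarian trick) with strict inequality near `g₀`, an open set of positive Haar measure. -/
theorem hasAreaLaw_two_of_isIrreducibleFamily [NeZero N] (hρ : Continuous ρ)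
    (hirr : IsIrreducibleFamily fun g : G => ρ g) (hlt : ∃ g₀ : G, ‖(ρ g₀).trace‖ < N) (β : ℝ) :
    HasAreaLaw 2 ρ β := by
  obtain ⟨g₀, hg₀⟩ := hlt
  have hN : (0 : ℝ) < N := Nat.cast_pos.mpr (NeZero.pos N)
  have htrc : Continuous fun g : G => (ρ g).trace := hρ.matrix_trace
  have htr : Continuous fun g : G => (ρ g).trace.re := Complex.continuous_re.comp htrc
  have hw : Continuous fun g : G => Real.exp (-(β * ((N : ℝ) - (ρ g).trace.re))) := by
    have := htr
    fun_prop
  have hwc : ∀ k g : G, Real.exp (-(β * ((N : ℝ) - (ρ (k * g * k⁻¹)).trace.re))) =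
      Real.exp (-(β * ((N : ℝ) - (ρ g).trace.re))) := fun k g => by
    rw [map_mul, map_mul, Matrix.trace_mul_cycle, ← map_mul, inv_mul_cancel, map_one, one_mul]
  -- Schur: the one-plaquette matrix commutes with `ρ`, hence is a scalar `c·1`
  obtain ⟨c, hc⟩ := hirr (Matrix.of fun k l : Fin N => ∫ g, ρ g k l *
      (Real.exp (-(β * ((N : ℝ) - (ρ g).trace.re))) : ℂ) ∂(haarProbability G))
    (fun g => (rep_mul_integralMatrix_comm ρ hρ hw hwc g).symm)
  refine hasAreaLaw_two_of_scalar ρ hρ β hc ?_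
  -- `N c = ∫ tr ρ · w`
  have hint : ∀ k : Fin N, Integrable (fun g : G => ρ g k k *
      (Real.exp (-(β * ((N : ℝ) - (ρ g).trace.re))) : ℂ)) (haarProbability G) := fun k =>
    integrable_haarProbability_of_continuous ((hρ.matrix_elem k k).mul (Complex.continuous_ofReal.comp hw))
  have hMtrace : (Matrix.of fun k l : Fin N => ∫ g, ρ g k l *
      (Real.exp (-(β * ((N : ℝ) - (ρ g).trace.re))) : ℂ) ∂(haarProbability G)).trace =
      ∫ g, (ρ g).trace * (Real.exp (-(β * ((N : ℝ) - (ρ g).trace.re))) : ℂ) ∂(haarProbability G) := by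
    symm
    calc ∫ g, (ρ g).trace * (Real.exp (-(β * ((N : ℝ) - (ρ g).trace.re))) : ℂ) ∂(haarProbability G)
        = ∫ g, ∑ k, ρ g k k * (Real.exp (-(β * ((N : ℝ) - (ρ g).trace.re))) : ℂ) ∂(haarProbability G) := by
          refine integral_congr_ae (ae_of_all _ fun g => ?_)
          simp only [Matrix.trace, Matrix.diag_apply, Finset.sum_mul]
      _ = ∑ k, ∫ g, ρ g k k * (Real.exp (-(β * ((N : ℝ) - (ρ g).trace.re))) : ℂ) ∂(haarProbability G) :=
          integral_finsetSum _ fun k _ => hint k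
      _ = _ := by simp only [Matrix.trace, Matrix.diag_apply, Matrix.of_apply]
  have hcN : c * (N : ℂ) = ∫ g, (ρ g).trace * (Real.exp (-(β * ((N : ℝ) - (ρ g).trace.re))) : ℂ)
      ∂(haarProbability G) := by
    have h := congrArg Matrix.trace hc
    rw [hMtrace, Matrix.trace_smul, Matrix.trace_one, Fintype.card_fin, smul_eq_mul] at h
    exact h.symm
  -- `‖tr ρ(g)‖ ≤ N` (unitarian trick) and the strict inequality near `g₀`
  have hle : ∀ g : G, ‖(ρ g).trace‖ ≤ N := norm_trace_le_card ρ hρ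
  have hnorm : ‖∫ g, (ρ g).trace * (Real.exp (-(β * ((N : ℝ) - (ρ g).trace.re))) : ℂ) ∂(haarProbability G)‖ ≤
      ∫ g, ‖(ρ g).trace‖ * Real.exp (-(β * ((N : ℝ) - (ρ g).trace.re))) ∂(haarProbability G) := by
    refine (norm_integral_le_integral_norm _).trans_eq (integral_congr_ae (ae_of_all _ fun g => ?_))
    simp only [norm_mul, Complex.norm_real, Real.norm_eq_abs, abs_of_pos (Real.exp_pos _)]
  have hpos : 0 < ∫ g, ((N : ℝ) - ‖(ρ g).trace‖) * Real.exp (-(β * ((N : ℝ) - (ρ g).trace.re)))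
      ∂(haarProbability G) := by
    refine Continuous.integral_pos_of_hasCompactSupport_nonneg_nonzero (x := g₀)
      ((continuous_const.sub htrc.norm).mul hw) (HasCompactSupport.of_compactSpace _)
      (fun g => mul_nonneg (by linarith [hle g]) (Real.exp_pos _).le) ?_
    exact mul_ne_zero (by linarith) (Real.exp_pos _).ne'
  have hwi : Integrable (fun g : G => Real.exp (-(β * ((N : ℝ) - (ρ g).trace.re)))) (haarProbability G) :=
    integrable_haarProbability_of_continuous hw
  have hsplit : ∫ g, ((N : ℝ) - ‖(ρ g).trace‖) * Real.exp (-(β * ((N : ℝ) - (ρ g).trace.re)))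
      ∂(haarProbability G) =
      N * (∫ g, Real.exp (-(β * ((N : ℝ) - (ρ g).trace.re))) ∂(haarProbability G)) -
        ∫ g, ‖(ρ g).trace‖ * Real.exp (-(β * ((N : ℝ) - (ρ g).trace.re))) ∂(haarProbability G) := by
    have hni : Integrable (fun g : G => ‖(ρ g).trace‖ * Real.exp (-(β * ((N : ℝ) - (ρ g).trace.re))))
        (haarProbability G) :=
      integrable_haarProbability_of_continuous (htrc.norm.mul hw)
    simp_rw [sub_mul]
    rw [integral_sub (hwi.const_mul _) hni, integral_const_mul]
  rw [hsplit] at hpos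
  have hlt' : ‖c‖ * N < (∫ g, Real.exp (-(β * ((N : ℝ) - (ρ g).trace.re))) ∂(haarProbability G)) * N := by
    calc ‖c‖ * N = ‖c * (N : ℂ)‖ := by rw [norm_mul, Complex.norm_natCast]
      _ ≤ ∫ g, ‖(ρ g).trace‖ * Real.exp (-(β * ((N : ℝ) - (ρ g).trace.re))) ∂(haarProbability G) := by
          rw [hcN]; exact hnorm
      _ < (∫ g, Real.exp (-(β * ((N : ℝ) - (ρ g).trace.re))) ∂(haarProbability G)) * N := by linarith
  exact lt_of_mul_lt_mul_right hlt' hN.le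

end General

/-! ## `U(N)` and `SU(N)` -/

section Unitary

/-- **TWO-DIMENSIONAL `U(N)` LATTICE YANG–MILLS SATISFIES THE VOLUME-UNIFORM AREA LAW AT EVERY COUPLING**:
`HasAreaLaw 2 (unitaryFundamentalRep (Fin N) ℂ) β` for every `N ≥ 1` and every real `β` — constants `C`,
`c > 0` (depending on `N, β` only) with `|⟨W_{R×T}⟩_{(ℤ/L)², β}| ≤ C^{2(R+T)} e^{−cRT}` for all `L`, both
planes, all base points and all `1 ≤ R, T ≤ L/2`. -/
theorem hasAreaLaw_two_unitary (N : ℕ) [NeZero N] (β : ℝ) :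
    HasAreaLaw 2 (unitaryFundamentalRep (Fin N) ℂ) β := by
  have hF : Continuous fun x : ℝ => Real.exp (-(β * ((N : ℝ) - x))) := by fun_prop
  have hN : (0 : ℝ) < N := Nat.cast_pos.mpr (NeZero.pos N)
  refine hasAreaLaw_two_of_trace_re_lt (unitaryFundamentalRep (Fin N) ℂ)
    (continuous_unitaryFundamentalRep (Fin N) ℂ) β ?_ ⟨-1, ?_⟩
  · simp only [unitaryFundamentalRep_apply]
    exact unitary_integralMatrix_eq_smul_one N hF
  · rw [unitaryFundamentalRep_apply, Unitary.coe_neg, OneMemClass.coe_one, Matrix.trace_neg,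
      Matrix.trace_one, Fintype.card_fin, Complex.neg_re, Complex.natCast_re]
    linarith

end Unitary

section SpecialUnitary

/-- **TWO-DIMENSIONAL `SU(N)` LATTICE YANG–MILLS SATISFIES THE VOLUME-UNIFORM AREA LAW AT EVERY COUPLING**:
`HasAreaLaw 2 (fundamentalRep (Fin N)) β` for every `N ≥ 2` and every real `β`. -/
theorem hasAreaLaw_two_specialUnitary (N : ℕ) (hN2 : 2 ≤ N) (β : ℝ) :
    HasAreaLaw 2 (fundamentalRep (Fin N)) β := by
  haveI : NeZero N := ⟨by omega⟩
  have hF : Continuous fun x : ℝ => Real.exp (-(β * ((N : ℝ) - x))) := by fun_prop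
  -- a special unitary matrix with `Re tr < N`: `diag(−1, −1, 1, …, 1)`
  set a : Fin N := ⟨0, by omega⟩ with ha
  set b : Fin N := ⟨1, by omega⟩ with hb
  have hab : a ≠ b := by simp [ha, hb, Fin.ext_iff]
  refine hasAreaLaw_two_of_trace_re_lt (fundamentalRep (Fin N)) (continuous_fundamentalRep (Fin N)) β ?_
    ⟨dPairHom a b (circleOfNormEqOne (-1) (by simp)), ?_⟩
  · simp only [fundamentalRep_apply]
    exact specialUnitary_integralMatrix_eq_smul_one N hF
  · rw [fundamentalRep_apply, coe_dPairHom, Matrix.trace_diagonal, Complex.re_sum, coe_circleOfNormEqOne]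
    have hterm : ∀ i, (pairFun a b (-1 : ℂ) i).re ≤ 1 := fun i =>
      (Complex.re_le_norm _).trans_eq (by
        simpa using norm_pairFun a b (circleOfNormEqOne (-1) (by simp)) i)
    have ha' : (pairFun a b (-1 : ℂ) a).re = -1 := by
      simp [pairFun, hab]
    rw [← Finset.sum_erase_add _ _ (Finset.mem_univ a), ha']
    have hsum : ∑ i ∈ Finset.univ.erase a, (pairFun a b (-1 : ℂ) i).re ≤ ((Finset.univ.erase a).card : ℝ) := by
      have h := Finset.sum_le_sum (s := Finset.univ.erase a) fun i _ => hterm i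
      simpa using h
    rw [Finset.card_erase_of_mem (Finset.mem_univ a), Finset.card_univ, Fintype.card_fin,
      Nat.cast_sub (by omega), Nat.cast_one] at hsum
    linarith

end SpecialUnitary

end Summit.Ventures.LatticeQCDFlow.Scoring
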